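/-
Copyright (c) 2026 the pub-hodgecm-mathlib formalisation cell (harness21).  Prover seat hodgecm-mathlib-K2Liu-p10 (g4), Track B «K2-LIT»,
#184♮ = hLiu418 = `stmt-HodgeConjecture-24832`; organ S2 «ARCH SPAN BY K-TYPE PATHS», file S2-K K-2c (LEAD F0P6-plan (g14) RULING M-158f row K «`ℂ[u,det⁻¹] = ⊕_λ W_λ`»;
DESIGN-S2 §3 (viii) «K-finite `A ↦ F_A = Σ_λ F_λ` (finite)»; ref1 TESTVECTORS-S2T (K-ii) «spanning by the ONE straightening identity»).  KERNEL: theorems only.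
-/
import Summits.HodgeConjecture.HodgeConjecture.Theorems.K2LiuU22KTypeStructure   -- ★ K-2b p860274 (cyclicity `kType_le_of_fkl_mem`; brings K-2a, K-1b, K-1, DEFS)
import HarnessLib

/-!
# Crux `HLiu418`, organ S2, file S2-K K-2c: THE PIERI RULE `u_{ij}·W_{(k+l,l)} ⊆ W_{(k+1+l,l)} + W_{(k+l,l+1)}` AND SPANNING `Σ_{k,l} W_{(k+l,l)} = ℂ[u, D⁻¹]`

Cell `hodgecm-mathlib`, crux item hLiu418 = `stmt-HodgeConjecture-24832`, route of record `HCCMUnconditional`; squad K2 ∕ K2Liu, prover K2Liu-p10 (g4).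
THEOREMS ONLY (no `def`, no `instance`, no notation, no named-fact hypothesis, no `sorry`); lane `--supports stmt-HodgeConjecture-24832 --as helper`.

S2-asm's step (viii) reads a `K_w`-finite compact-picture function `F_A ∈ 𝒜` as a FINITE SUM of vectors in the K-types `W_λ`; this file proves that every element
of `𝒜 = ℂ[u, D⁻¹]` is such a sum — **`iSup_kType_eq_top`** — by the cheapest road the K-files allow:
* §1 the ONE straightening identity `(k+1)·u₀₀^k u₁₁ = H_k + k·u₀₀^{k−1}·D` (`u₀₁u₁₀ = u₀₀u₁₁ − D`), hence `u_{ij}·F_{k,l} ∈ W_{k+1,l} + W_{k−1,l+1}` for all four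
  entries (★ K-1 memberships);
* §2 **THE PIERI RULE `uMat_mul_mem_sup`**: `u_{ij}·W_{k,l} ⊆ W_{k+1,l} ⊔ W_{k−1,l+1}` — the subspace `{f : ∀ ij, u_{ij} f ∈ W_{k+1,l} ⊔ W_{k−1,l+1}}` is stable under the
  `𝔨_ℂ` fields (Leibniz: `u_{ij}·X f = X(u_{ij} f) − (X u_{ij})·f`, ★ K-1b stability) and contains `F_{k,l}` (§1), so it contains `W_{k,l}` by CYCLICITY (★ K-2b);
* §3 **SPANNING**: `Σ W` is closed under multiplication by the `u_{ij}` (Pieri) and by `D⁻¹` (`l ↦ l−1`) and contains `1`; every element is `P(u)·D^{−n}`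
  (★ `IsLocalization.surj`) ⇒ **`mem_iSup_kType`**, **`iSup_kType_eq_top`**, and the finite-sum form **`exists_finset_sum_eq`**.
Directness of the sum and irreducibility are not needed downstream and are not typed.

HONEST LABEL: HC_CM is proved only modulo the 7 printed citations (2 remaining named inputs: hLiu418 = stmt-HodgeConjecture-24832, h413 = stmt-HodgeConjecture-24833)
until rung 0 closes; helper, closes no item.
References: [KashiwaraVergne1978] M. Kashiwara, M. Vergne, Invent. Math. 44 (1978) §II.5 (decomposition of polynomial functions on matrices under `GL × GL`);
[Howe1989Remarks] R. Howe, Trans. AMS 313 (1989) §2; [LeeZhu1998] S. T. Lee, C.-B. Zhu, Trans. AMS 350 (1998) p. 5032.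
-/

set_option autoImplicit false
set_option linter.dupNamespace false -- the mandated namespace repeats `HodgeConjecture.HodgeConjecture`

noncomputable section

open Matrix MvPolynomial
open Summit.HodgeConjecture.HodgeConjecture.Cruxes.HLiu418.K2LiuU22CompactPictureDefs
open Summit.HodgeConjecture.HodgeConjecture.Cruxes.HLiu418.K2LiuU22KTypeMembership
open Summit.HodgeConjecture.HodgeConjecture.Cruxes.HLiu418.K2LiuU22KTypeStability
open Summit.HodgeConjecture.HodgeConjecture.Cruxes.HLiu418.K2LiuU22KTypeStructure

namespace Summit.HodgeConjecture.HodgeConjecture.Cruxes.HLiu418.K2LiuU22KTypeSpanning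

/-! ## §1 The straightening identity and `u_{ij}·F_{k,l}` -/

/-- `D = u₀₀u₁₁ − u₀₁u₁₀` as `dz 1`. [folklore] -/
theorem dz_one_eq : dz 1 = uMat 0 0 * uMat 1 1 - uMat 0 1 * uMat 1 0 := by
  rw [dz_one, Matrix.det_fin_two]

/-- **THE STRAIGHTENING IDENTITY**: `(k+1)·u₀₀^k u₁₁ D^l = H_k D^l + k·u₀₀^{k−1} D^{l+1}` (`u₀₁u₁₀ = u₀₀u₁₁ − D`; the factor `k` in front makes `k = 0` need no side condition).
[cite: KashiwaraVergne1978, §II.5] -/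
theorem straighten (k : ℕ) (l : ℤ) :
    ((k : ℂ) + 1) • (uMat 0 0 ^ k * uMat 1 1 * dz l) = hk uMat k * dz l + (k : ℂ) • (uMat 0 0 ^ (k - 1) * dz (l + 1)) := by
  rw [hk_apply, dz_add, dz_one_eq]
  rcases k with _ | k
  · simp
  · simp only [Nat.add_sub_cancel, Nat.cast_succ, pow_succ, Algebra.smul_def, map_add, map_one, map_natCast]
    ring

/-- `u₁₁·F_{k,l} ∈ W_{k+1,l} ⊔ W_{k−1,l+1}` (by straightening and ★ K-1). [cite: KashiwaraVergne1978, §II.5] -/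
theorem u11_mul_fkl_mem (k : ℕ) (l : ℤ) : uMat 1 1 * fkl uMat dz k l ∈ kType (k + 1) l ⊔ kType (k - 1) (l + 1) := by
  have hk1 : ((k : ℂ) + 1) ≠ 0 := by exact_mod_cast Nat.succ_ne_zero k
  have hmem : ((k : ℂ) + 1) • (uMat 0 0 ^ k * uMat 1 1 * dz l) ∈ kType (k + 1) l ⊔ kType (k - 1) (l + 1) := by
    rw [straighten]
    exact Submodule.add_mem _ (Submodule.mem_sup_left (hk_mul_dz_mem k l)) (Submodule.mem_sup_right (Submodule.smul_mem _ _ (u00_pow_mul_dz_mem (k - 1) (l + 1))))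
  have h := Submodule.smul_mem _ ((k : ℂ) + 1)⁻¹ hmem
  rw [inv_smul_smul₀ hk1] at h
  have e : uMat 1 1 * fkl uMat dz k l = uMat 0 0 ^ k * uMat 1 1 * dz l := by rw [fkl_apply]; ring
  rwa [e]

/-- `u_{ij}·F_{k,l} ∈ W_{k+1,l} ⊔ W_{k−1,l+1}` for all four entries. [cite: KashiwaraVergne1978, §II.5] -/
theorem uMat_mul_fkl_mem (i j : Fin 2) (k : ℕ) (l : ℤ) : uMat i j * fkl uMat dz k l ∈ kType (k + 1) l ⊔ kType (k - 1) (l + 1) := by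
  have hi : i = 0 ∨ i = 1 := by fin_cases i <;> simp
  have hj : j = 0 ∨ j = 1 := by fin_cases j <;> simp
  rcases hi with rfl | rfl <;> rcases hj with rfl | rfl
  · refine Submodule.mem_sup_left ?_
    have e : uMat 0 0 * fkl uMat dz k l = uMat 0 0 ^ (k + 1) * dz l := by rw [fkl_apply, pow_succ]; ring
    rw [e]; exact u00_pow_mul_dz_mem (k + 1) l
  · refine Submodule.mem_sup_left ?_
    have e : uMat 0 1 * fkl uMat dz k l = uMat 0 0 ^ k * uMat 0 1 * dz l := by rw [fkl_apply]; ring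
    rw [e]; exact u00_pow_mul_u01_mul_dz_mem k l
  · refine Submodule.mem_sup_left ?_
    have e : uMat 1 0 * fkl uMat dz k l = uMat 0 0 ^ k * uMat 1 0 * dz l := by rw [fkl_apply]; ring
    rw [e]; exact u00_pow_mul_u10_mul_dz_mem k l
  · exact u11_mul_fkl_mem k l

/-! ## §2 The Pieri rule -/

/-- Leibniz rearranged: `u_{ij}·R_{ab} f = R_{ab}(u_{ij} f) − (R_{ab} u_{ij})·f`. [folklore] -/
theorem uMat_mul_rOp (a b i j : Fin 2) (f : Carrier) :
    uMat i j * rOp pd uMat a b f = rOp pd uMat a b (uMat i j * f) - rOp pd uMat a b (uMat i j) * f := by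
  rw [rOp_mul]; ring

/-- the same for `L_{ab}`. [folklore] -/
theorem uMat_mul_lOp (a b i j : Fin 2) (f : Carrier) :
    uMat i j * lOp pd uMat a b f = lOp pd uMat a b (uMat i j * f) - lOp pd uMat a b (uMat i j) * f := by
  rw [lOp_mul]; ring

/-- **THE PIERI RULE**: `u_{ij}·W_{(k+l,l)} ⊆ W_{(k+1+l,l)} ⊔ W_{(k+l,l+1)}` — the subspace of `f` with all `u_{ij} f` in the right-hand side is `𝔨_ℂ`-stable and contains
`F_{k,l}`, hence contains `W_{k,l}` by cyclicity (★ K-2b). [cite: KashiwaraVergne1978, §II.5] [cite: Howe1989Remarks, §2] -/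
theorem uMat_mul_mem_sup (i j : Fin 2) (k : ℕ) (l : ℤ) {f : Carrier} (hf : f ∈ kType k l) : uMat i j * f ∈ kType (k + 1) l ⊔ kType (k - 1) (l + 1) := by
  -- `S := {f | ∀ i j, u_{ij} f ∈ T′}`
  let T' : Submodule ℂ Carrier := kType (k + 1) l ⊔ kType (k - 1) (l + 1)
  let S : Submodule ℂ Carrier := ⨅ ij : Fin 2 × Fin 2, T'.comap (LinearMap.mulLeft ℂ (uMat ij.1 ij.2))
  have hS : ∀ g : Carrier, g ∈ S ↔ ∀ i' j' : Fin 2, uMat i' j' * g ∈ T' := fun g => by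
    simp only [S, Submodule.mem_iInf, Submodule.mem_comap, LinearMap.mulLeft_apply, Prod.forall]
  -- `T′` is stable under the fields (★ K-1b)
  have hT'R : ∀ a b : Fin 2, ∀ g ∈ T', rOp pd uMat a b g ∈ T' := fun a b g hg => by
    obtain ⟨y, hy, z, hz, rfl⟩ := Submodule.mem_sup.1 hg
    rw [map_add]
    exact Submodule.add_mem _ (Submodule.mem_sup_left (rOp_mem_kType a b _ _ hy)) (Submodule.mem_sup_right (rOp_mem_kType a b _ _ hz))
  have hT'L : ∀ a b : Fin 2, ∀ g ∈ T', lOp pd uMat a b g ∈ T' := fun a b g hg => by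
    obtain ⟨y, hy, z, hz, rfl⟩ := Submodule.mem_sup.1 hg
    rw [map_add]
    exact Submodule.add_mem _ (Submodule.mem_sup_left (lOp_mem_kType a b _ _ hy)) (Submodule.mem_sup_right (lOp_mem_kType a b _ _ hz))
  -- `S` is stable under the fields
  have hSR : ∀ a b : Fin 2, ∀ g ∈ S, rOp pd uMat a b g ∈ S := fun a b g hg => by
    rw [hS] at hg ⊢
    intro i' j'
    rw [uMat_mul_rOp, rOp_u pd uMat pd_uMat]
    refine Submodule.sub_mem _ (hT'R a b _ (hg i' j')) ?_
    split_ifs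
    · exact hg i' a
    · rw [zero_mul]; exact Submodule.zero_mem _
  have hSL : ∀ a b : Fin 2, ∀ g ∈ S, lOp pd uMat a b g ∈ S := fun a b g hg => by
    rw [hS] at hg ⊢
    intro i' j'
    rw [uMat_mul_lOp, lOp_u pd uMat pd_uMat]
    refine Submodule.sub_mem _ (hT'L a b _ (hg i' j')) ?_
    split_ifs
    · exact hg b j'
    · rw [zero_mul]; exact Submodule.zero_mem _
  -- `F_{k,l} ∈ S` (§1) ⇒ `W_{k,l} ≤ S` (★ cyclicity)
  have hF : fkl uMat dz k l ∈ S := (hS _).2 fun i' j' => uMat_mul_fkl_mem i' j' k l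
  have hle : kType k l ≤ S := kType_le_of_fkl_mem S (hSL 0 1) (hSR 1 0) k l hF
  exact ((hS f).1 (hle hf)) i j

/-! ## §3 Spanning -/

/-- `D⁻¹·W_{(k+l,l)} ⊆ W_{(k+l−1,l−1)}`. [folklore] -/
theorem dInv_mul_mem (k : ℕ) (l : ℤ) {f : Carrier} (hf : f ∈ kType k l) : dInv * f ∈ kType k (l - 1) := by
  have hle : kType k l ≤ (kType k (l - 1)).comap (LinearMap.mulLeft ℂ dInv) := by
    refine Submodule.span_le.2 ?_
    rintro _ ⟨ξ, η, rfl⟩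
    show dInv * (dz l * bil uMat ξ η ^ k) ∈ kType k (l - 1)
    have e : dInv * (dz l * bil uMat ξ η ^ k) = dz (l - 1) * bil uMat ξ η ^ k := by
      rw [← dz_neg_one, ← mul_assoc, ← dz_add, show -1 + l = l - 1 by ring]
    rw [e]
    exact dz_mul_bil_pow_mem_kType k (l - 1) ξ η
  exact hle hf

/-- `Σ W` is closed under multiplication by the coordinates. [cite: KashiwaraVergne1978, §II.5] -/
theorem uMat_mul_mem_iSup (i j : Fin 2) {t : Carrier} (ht : t ∈ ⨆ kl : ℕ × ℤ, kType kl.1 kl.2) : uMat i j * t ∈ ⨆ kl : ℕ × ℤ, kType kl.1 kl.2 := by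
  refine Submodule.iSup_induction (fun kl : ℕ × ℤ => kType kl.1 kl.2) (motive := fun t => uMat i j * t ∈ ⨆ kl : ℕ × ℤ, kType kl.1 kl.2) ht ?_ ?_ ?_
  · intro kl x hx
    obtain ⟨y, hy, z, hz, hyz⟩ := Submodule.mem_sup.1 (uMat_mul_mem_sup i j kl.1 kl.2 hx)
    rw [← hyz]
    exact Submodule.add_mem _ (Submodule.mem_iSup_of_mem (kl.1 + 1, kl.2) hy) (Submodule.mem_iSup_of_mem (kl.1 - 1, kl.2 + 1) hz)
  · rw [mul_zero]; exact Submodule.zero_mem _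
  · intro x y hx hy
    rw [mul_add]; exact Submodule.add_mem _ hx hy

/-- `Σ W` is closed under multiplication by `D⁻¹`. [folklore] -/
theorem dInv_mul_mem_iSup {t : Carrier} (ht : t ∈ ⨆ kl : ℕ × ℤ, kType kl.1 kl.2) : dInv * t ∈ ⨆ kl : ℕ × ℤ, kType kl.1 kl.2 := by
  refine Submodule.iSup_induction (fun kl : ℕ × ℤ => kType kl.1 kl.2) (motive := fun t => dInv * t ∈ ⨆ kl : ℕ × ℤ, kType kl.1 kl.2) ht ?_ ?_ ?_
  · intro kl x hx
    exact Submodule.mem_iSup_of_mem (kl.1, kl.2 - 1) (dInv_mul_mem kl.1 kl.2 hx)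
  · rw [mul_zero]; exact Submodule.zero_mem _
  · intro x y hx hy
    rw [mul_add]; exact Submodule.add_mem _ hx hy

/-- `1 ∈ W_{(0,0)}`. [folklore] -/
theorem one_mem_kType : (1 : Carrier) ∈ kType 0 0 := by
  have h := fkl_mem_kType 0 0
  rwa [fkl_apply, pow_zero, dz_zero, mul_one] at h

/-- polynomials in the coordinates lie in `Σ W`. [cite: KashiwaraVergne1978, §II.5] -/
theorem algebraMap_mem_iSup (P : MvPolynomial (Fin 2 × Fin 2) ℂ) :
    algebraMap (MvPolynomial (Fin 2 × Fin 2) ℂ) Carrier P ∈ ⨆ kl : ℕ × ℤ, kType kl.1 kl.2 := by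
  induction P using MvPolynomial.induction_on with
  | C c =>
    have hc : algebraMap (MvPolynomial (Fin 2 × Fin 2) ℂ) Carrier (C c) = c • (1 : Carrier) := by
      have h1 : algebraMap (MvPolynomial (Fin 2 × Fin 2) ℂ) Carrier (C c) = algebraMap ℂ Carrier c :=
        (IsScalarTower.algebraMap_apply ℂ (MvPolynomial (Fin 2 × Fin 2) ℂ) Carrier c).symm
      rw [h1, Algebra.algebraMap_eq_smul_one]
    rw [hc]
    exact Submodule.smul_mem _ _ (Submodule.mem_iSup_of_mem ((0 : ℕ), (0 : ℤ)) one_mem_kType)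
  | add p q hp hq => rw [map_add]; exact Submodule.add_mem _ hp hq
  | mul_X p ij hp =>
    rw [map_mul, show algebraMap (MvPolynomial (Fin 2 × Fin 2) ℂ) Carrier (X ij) = uMat ij.1 ij.2 from rfl, mul_comm]
    exact uMat_mul_mem_iSup ij.1 ij.2 hp

/-- `Σ W` is closed under multiplication by powers of `D⁻¹`. [folklore] -/
theorem dInv_pow_mul_mem_iSup (n : ℕ) {t : Carrier} (ht : t ∈ ⨆ kl : ℕ × ℤ, kType kl.1 kl.2) : dInv ^ n * t ∈ ⨆ kl : ℕ × ℤ, kType kl.1 kl.2 := by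
  induction n with
  | zero => rw [pow_zero, one_mul]; exact ht
  | succ n ih => rw [pow_succ', mul_assoc]; exact dInv_mul_mem_iSup ih

/-- **SPANNING**: every element of `𝒜 = ℂ[u, D⁻¹]` lies in `Σ_{(k,l)} W_{(k+l,l)}`. [cite: KashiwaraVergne1978, §II.5] [cite: Howe1989Remarks, §2] -/
theorem mem_iSup_kType (a : Carrier) : a ∈ ⨆ kl : ℕ × ℤ, kType kl.1 kl.2 := by
  obtain ⟨⟨P, D, n, hn⟩, hP⟩ := IsLocalization.surj (Submonoid.powers detPoly) a
  simp only at hn hP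
  have hP' : a * uMat.det ^ n = algebraMap (MvPolynomial (Fin 2 × Fin 2) ℂ) Carrier P := by
    rw [det_uMat, ← map_pow, hn]; exact hP
  have ha : a = dInv ^ n * algebraMap (MvPolynomial (Fin 2 × Fin 2) ℂ) Carrier P := by
    calc a = a * (uMat.det ^ n * dInv ^ n) := by rw [← mul_pow, det_uMat_mul_dInv, one_pow, mul_one]
      _ = dInv ^ n * algebraMap (MvPolynomial (Fin 2 × Fin 2) ℂ) Carrier P := by rw [← mul_assoc, hP', mul_comm]
  rw [ha]
  exact dInv_pow_mul_mem_iSup n (algebraMap_mem_iSup P)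

/-- **`Σ_{(k,l)} W_{(k+l,l)} = ℂ[u, D⁻¹]`** (as a supremum of subspaces). [cite: KashiwaraVergne1978, §II.5] [cite: LeeZhu1998, p. 5032] -/
theorem iSup_kType_eq_top : (⨆ kl : ℕ × ℤ, kType kl.1 kl.2) = ⊤ :=
  Submodule.eq_top_iff'.2 mem_iSup_kType

/-- **THE FINITE-SUM FORM** (S2-asm (viii)): every `a ∈ 𝒜` is `Σ_{λ ∈ F} a_λ` over a FINITE set of labels with `a_λ ∈ W_λ`. [cite: KashiwaraVergne1978, §II.5] -/
theorem exists_finset_sum_eq (a : Carrier) :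
    ∃ (F : Finset (ℕ × ℤ)) (s : ℕ × ℤ → Carrier), (∀ kl ∈ F, s kl ∈ kType kl.1 kl.2) ∧ ∑ kl ∈ F, s kl = a := by
  classical
  obtain ⟨f, hf⟩ := (Submodule.mem_iSup_iff_exists_dfinsupp' (fun kl : ℕ × ℤ => kType kl.1 kl.2) a).1 (mem_iSup_kType a)
  refine ⟨f.support, fun kl => (f kl : Carrier), fun kl _ => (f kl).2, ?_⟩
  rw [← hf]
  rfl

end Summit.HodgeConjecture.HodgeConjecture.Cruxes.HLiu418.K2LiuU22KTypeSpanning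

end
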